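import Mathlib.Analysis.SpecialFunctions.Exp
import Mathlib.Analysis.SpecialFunctions.Pow.Real
import Mathlib.Analysis.Complex.ExponentialBounds
import HarnessLib

/-!
# Iterating the doubling recursion from one exit scale: `δ(L) ≤ C⁻¹ e^{−(L+1)/L_*}` for `L ≥ 2 L_*`

Support lemma for item `RecursionToGap` (stmt-QuantumFields-17755) of route `DoublingDefect`
(`QuantumFields/YangMills`): the elementary real-analysis half of the glue.  For a defect function
`δ : ℕ → ℝ` (one coupling `β` fixed) that is non-negative beyond `L₀`, satisfies the DOUBLING RECURSION
`δ(L') ≤ C δ(L)²` for `L ≥ L₀`, `L' ∈ [2L, 4L]`, and is small at ONE exit scale `L_* ≥ max(L₀, 1)`,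
`δ(L_*) ≤ 1/(16 C)`, the defect decays exponentially in the scale: `δ(L) ≤ C⁻¹ exp(−(L+1)/L_*)` for every
`L ≥ 2 L_*` (strong induction on `L`: the scales `[2L_*, 4L_*]` are reached from `L_*` in one step, every
larger `L'` from `⌊L'/2⌋`; the invariant `δ(L) ≤ C⁻¹ e^{−κ(L+1)}` squares into itself because
`L' + 1 ≤ 2 ⌊L'/2⌋ + 2`).  This is the "−log δ grows linearly in the scale" step of the route abstract.
[folklore]
-/

namespace Summit.QuantumFields.YangMills.Theorems.DoublingDefect

/-- `e⁵ ≤ 256` (from `e < 2.7182818286`). [folklore] -/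
theorem exp_five_le : Real.exp 5 ≤ 256 := by
  have h1 : Real.exp 1 < 2.7182818286 := Real.exp_one_lt_d9
  have h5 : Real.exp 5 = Real.exp 1 ^ 5 := by
    rw [← Real.exp_nat_mul]; norm_num
  rw [h5]
  have h0 : 0 ≤ Real.exp 1 := (Real.exp_pos 1).le
  calc Real.exp 1 ^ 5 ≤ (2.7182818286 : ℝ) ^ 5 := pow_le_pow_left₀ h0 h1.le 5
    _ ≤ 256 := by norm_num

/-- **Iterating the doubling recursion from one exit scale.**  If `δ ≥ 0` beyond `L₀`, `δ(L') ≤ C δ(L)²`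
for `L ≥ L₀` and `2L ≤ L' ≤ 4L`, and `δ(L_*) ≤ 1/(16C)` at one scale `L_* ≥ max(L₀, 1)`, then
`δ(L) ≤ C⁻¹ exp(−(L+1)/L_*)` for all `L ≥ 2L_*`. [folklore] -/
theorem defect_decay_of_recursion {δ : ℕ → ℝ} {C : ℝ} {L₀ Ls : ℕ} (hC : 0 < C)
    (hrec : ∀ L : ℕ, L₀ ≤ L → ∀ L' : ℕ, 2 * L ≤ L' → L' ≤ 4 * L → δ L' ≤ C * δ L ^ 2)
    (hnn : ∀ L : ℕ, L₀ ≤ L → 0 ≤ δ L)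
    (hLs : L₀ ≤ Ls) (hLs1 : 1 ≤ Ls) (hex : δ Ls ≤ 1 / (16 * C)) :
    ∀ L : ℕ, 2 * Ls ≤ L → δ L ≤ C⁻¹ * Real.exp (-(((L : ℝ) + 1) / Ls)) := by
  have hLsR : (1 : ℝ) ≤ Ls := by exact_mod_cast hLs1
  have hLs0 : (0 : ℝ) < Ls := by linarith
  -- base: the scales `[2 L_*, 4 L_*]`
  have hbase : ∀ L : ℕ, 2 * Ls ≤ L → L ≤ 4 * Ls → δ L ≤ C⁻¹ * Real.exp (-(((L : ℝ) + 1) / Ls)) := by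
    intro L h2 h4
    have hδ0 : 0 ≤ δ Ls := hnn Ls hLs
    have h1 : δ L ≤ C * δ Ls ^ 2 := hrec Ls hLs L h2 h4
    have h2' : δ Ls ^ 2 ≤ (1 / (16 * C)) ^ 2 := pow_le_pow_left₀ hδ0 hex 2
    have h3 : C * δ Ls ^ 2 ≤ C⁻¹ * (1 / 256) := by
      calc C * δ Ls ^ 2 ≤ C * (1 / (16 * C)) ^ 2 := mul_le_mul_of_nonneg_left h2' hC.le
        _ = C⁻¹ * (1 / 256) := by field_simp; ring
    -- `(L+1)/L_* ≤ 5`, so `e^{-(L+1)/L_*} ≥ e^{-5} ≥ 1/256`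
    have h5 : ((L : ℝ) + 1) / Ls ≤ 5 := by
      rw [div_le_iff₀ hLs0]
      have : (L : ℝ) ≤ 4 * Ls := by exact_mod_cast h4
      linarith
    have hexp : (1 : ℝ) / 256 ≤ Real.exp (-(((L : ℝ) + 1) / Ls)) := by
      have he : Real.exp (-5) ≤ Real.exp (-(((L : ℝ) + 1) / Ls)) := Real.exp_le_exp.2 (by linarith)
      refine le_trans ?_ he
      rw [Real.exp_neg, one_div]
      exact inv_anti₀ (Real.exp_pos 5) exp_five_le
    calc δ L ≤ C * δ Ls ^ 2 := h1
      _ ≤ C⁻¹ * (1 / 256) := h3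
      _ ≤ C⁻¹ * Real.exp (-(((L : ℝ) + 1) / Ls)) :=
          mul_le_mul_of_nonneg_left hexp (inv_nonneg.2 hC.le)
  -- strong induction on the scale
  intro L
  induction L using Nat.strong_induction_on with
  | _ L' ih =>
    intro h2
    by_cases h4 : L' ≤ 4 * Ls
    · exact hbase L' h2 h4
    · -- `L' > 4 L_*`: halve
      push Not at h4
      set L : ℕ := L' / 2 with hL
      have hL2 : 2 * L ≤ L' := by omega
      have hL2' : L' ≤ 2 * L + 1 := by omega
      have hLlt : L < L' := by omega
      have hL2Ls : 2 * Ls ≤ L := by omega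
      have hLL₀ : L₀ ≤ L := by omega
      have hL4 : L' ≤ 4 * L := by omega
      have hIH := ih L hLlt hL2Ls
      have hδL0 : 0 ≤ δ L := hnn L hLL₀
      have h1 : δ L' ≤ C * δ L ^ 2 := hrec L hLL₀ L' hL2 hL4
      have hsq : δ L ^ 2 ≤ (C⁻¹ * Real.exp (-(((L : ℝ) + 1) / Ls))) ^ 2 := pow_le_pow_left₀ hδL0 hIH 2
      have hkey : C * (C⁻¹ * Real.exp (-(((L : ℝ) + 1) / Ls))) ^ 2 =
          C⁻¹ * Real.exp (-((2 * ((L : ℝ) + 1)) / Ls)) := by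
        rw [mul_pow, ← Real.exp_nat_mul]
        push_cast
        have hC0 : C ≠ 0 := hC.ne'
        field_simp
      have hmono : Real.exp (-((2 * ((L : ℝ) + 1)) / Ls)) ≤ Real.exp (-(((L' : ℝ) + 1) / Ls)) := by
        refine Real.exp_le_exp.2 ?_
        have hle : (L' : ℝ) + 1 ≤ 2 * ((L : ℝ) + 1) := by
          have : (L' : ℝ) ≤ 2 * L + 1 := by exact_mod_cast hL2'
          linarith
        have := div_le_div_of_nonneg_right hle hLs0.le
        linarith
      calc δ L' ≤ C * δ L ^ 2 := h1
        _ ≤ C * (C⁻¹ * Real.exp (-(((L : ℝ) + 1) / Ls))) ^ 2 := mul_le_mul_of_nonneg_left hsq hC.le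
        _ = C⁻¹ * Real.exp (-((2 * ((L : ℝ) + 1)) / Ls)) := hkey
        _ ≤ C⁻¹ * Real.exp (-(((L' : ℝ) + 1) / Ls)) :=
            mul_le_mul_of_nonneg_left hmono (inv_nonneg.2 hC.le)

end Summit.QuantumFields.YangMills.Theorems.DoublingDefect
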